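import Summits.Ventures.PercRepro.C026AcyclicFactorTwo
import Summits.Ventures.PercRepro.C026AcyclicBridges
import Summits.Ventures.PercRepro.GladkovThm13

/-!
# mine-3's `Q3½` at every `p` on forests (p6, gen 10)

The one-parameter family `Q3_λ : (1 + λ)·x ≤ u·(1 + λ·v)` (`x = P(abc)`, `u = P(c ~ {a, b})`,
`v = P(a ~ b)`; dossier §12) interpolates between the trivial `x ≤ u` (`λ = 0`) and the Harris direction;
`λ = 1` is C-026 and `λ = 2` is `Q3½ : P(a~b)·P(c iso) ≤ P(ab|c) + ½[P(ac|b) + P(bc|a)]`, the largest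
class-level constant (tight on the claw).  Its class form on a marked minor is `TwoTimesIneq`
(`2·#BotM ≤ #ac|b + #bc|a`, p5's S7), which holds on every acyclic multigraph (`Acyclic.twoTimesIneq`)
and is minor-closed there (`Acyclic.minor`).  Through typer-2's antipodal principle
(`quadForm_nonneg_of_minors`) with the kernel `kernelHalf` of `Q3½`:

* `kernelHalf`, `quadForm_kernelHalf` — the form is `u·1 + 2uv − 3x·1` with `1 = Σ rows`;
* `kernelHalf_eq_ite`, `cubeSumQuad_kernelHalf_eq` — the class sum is `#U + 2·#{U(ρ) ∧ a ~ b in ρᶜ} − 3·#abc`;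
* `card_U_and_conn_compl` — `#{U(ρ) ∧ a ~ b in ρᶜ} = #abc − #BotM` (the complement bijection and p5's
  pairing `card_conn_cIso_compl_eq_card_badM`), so the class sum is `#ac|b + #bc|a − 2·#BotM`
  (`cubeSumQuad_kernelHalf_nonneg_iff`);
* **`Acyclic.q3half`** — `Q3½` at every `p ∈ [0,1]^E` on acyclic marked multigraphs:
  `3·x ≤ u·(1 + 2·v)`, equivalently `(x + y₁)(y₁ + z) ≤ y₁ + (y₂ + y₃)/2`.
-/

namespace PercRepro

open Finset

/-- The sum of the five row indicators (equal to `1` on every marked partition). -/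
noncomputable def rowAll3 (τ : Setoid (Fin 3)) : ℝ :=
  rowInd3 0 τ + rowInd3 1 τ + rowInd3 2 τ + rowInd3 3 τ + rowInd3 4 τ

/-- **The kernel of `Q3½`**: `[σ ∈ U]·1 + 2·[σ ∈ U]·[τ joins ab] − 3·[σ = abc]·1` through the rows
(`U = c ~ {a, b}` = rows `0, 2, 3`; `a ~ b` = rows `0, 1`; `1 = rowAll3`). -/
noncomputable def kernelHalf (σ τ : Setoid (Fin 3)) : ℝ :=
  (rowInd3 0 σ + rowInd3 2 σ + rowInd3 3 σ) * rowAll3 τ +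
    (2 * (rowInd3 0 σ + rowInd3 2 σ + rowInd3 3 σ)) * (rowInd3 0 τ + rowInd3 1 τ) -
      (3 * rowInd3 0 σ) * rowAll3 τ

namespace MultiGraph

variable {V E : Type*} (G : MultiGraph V E) [Fintype E] [DecidableEq E]

/-- The expectation of `rowAll3` is the sum of the five rows. -/
theorem sum_weight_mul_rowAll3 (p : E → ℝ) (a b c : V) :
    (∑ ω : Config E, weight p ω * rowAll3 (G.markedPartition ω ![a, b, c])) =
      G.law3 p a b c 0 + G.law3 p a b c 1 + G.law3 p a b c 2 + G.law3 p a b c 3 +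
        G.law3 p a b c 4 := by
  unfold rowAll3
  simp only [mul_add, Finset.sum_add_distrib, law3_eq_sum_rowInd3]

/-- The expectation of the `U`-indicator is `x + y₂ + y₃`. -/
theorem sum_weight_mul_rowU (p : E → ℝ) (a b c : V) :
    (∑ ω : Config E, weight p ω * (rowInd3 0 (G.markedPartition ω ![a, b, c]) +
      rowInd3 2 (G.markedPartition ω ![a, b, c]) + rowInd3 3 (G.markedPartition ω ![a, b, c]))) =
      G.law3 p a b c 0 + G.law3 p a b c 2 + G.law3 p a b c 3 := by
  simp only [mul_add, Finset.sum_add_distrib, law3_eq_sum_rowInd3]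

/-- The expectation of the `a ~ b` indicator is `x + y₁`. -/
theorem sum_weight_mul_rowAB (p : E → ℝ) (a b c : V) :
    (∑ ω : Config E, weight p ω * (rowInd3 0 (G.markedPartition ω ![a, b, c]) +
      rowInd3 1 (G.markedPartition ω ![a, b, c]))) = G.law3 p a b c 0 + G.law3 p a b c 1 := by
  simp only [mul_add, Finset.sum_add_distrib, law3_eq_sum_rowInd3]

/-- **The quadratic form of `kernelHalf`** is `u·1 + 2·u·v − 3·x·1` (`1 = Σ rows`). -/
theorem quadForm_kernelHalf (p : E → ℝ) (a b c : V) :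
    G.quadForm p ![a, b, c] kernelHalf =
      (G.law3 p a b c 0 + G.law3 p a b c 2 + G.law3 p a b c 3) *
          (G.law3 p a b c 0 + G.law3 p a b c 1 + G.law3 p a b c 2 + G.law3 p a b c 3 +
            G.law3 p a b c 4) +
        (2 * (G.law3 p a b c 0 + G.law3 p a b c 2 + G.law3 p a b c 3)) *
          (G.law3 p a b c 0 + G.law3 p a b c 1) -
        (3 * G.law3 p a b c 0) *
          (G.law3 p a b c 0 + G.law3 p a b c 1 + G.law3 p a b c 2 + G.law3 p a b c 3 +
            G.law3 p a b c 4) := by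
  unfold quadForm
  have key : ∀ ω ω' : Config E,
      weight p ω * weight p ω' * kernelHalf (G.markedPartition ω ![a, b, c])
          (G.markedPartition ω' ![a, b, c]) =
        weight p ω * weight p ω' * ((rowInd3 0 (G.markedPartition ω ![a, b, c]) +
            rowInd3 2 (G.markedPartition ω ![a, b, c]) + rowInd3 3 (G.markedPartition ω ![a, b, c])) *
          rowAll3 (G.markedPartition ω' ![a, b, c])) +
        weight p ω * weight p ω' * ((2 * (rowInd3 0 (G.markedPartition ω ![a, b, c]) +
            rowInd3 2 (G.markedPartition ω ![a, b, c]) + rowInd3 3 (G.markedPartition ω ![a, b, c]))) *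
          (rowInd3 0 (G.markedPartition ω' ![a, b, c]) + rowInd3 1 (G.markedPartition ω' ![a, b, c]))) -
        weight p ω * weight p ω' * ((3 * rowInd3 0 (G.markedPartition ω ![a, b, c])) *
          rowAll3 (G.markedPartition ω' ![a, b, c])) := by
    intro ω ω'
    unfold kernelHalf
    ring
  simp only [key, Finset.sum_add_distrib, Finset.sum_sub_distrib]
  rw [sum_sum_weight_mul_mul, sum_sum_weight_mul_mul, sum_sum_weight_mul_mul,
    G.sum_weight_mul_rowAll3, G.sum_weight_mul_rowU, G.sum_weight_mul_rowAB]
  have h2 : (∑ ω : Config E, weight p ω * (2 * (rowInd3 0 (G.markedPartition ω ![a, b, c]) +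
      rowInd3 2 (G.markedPartition ω ![a, b, c]) + rowInd3 3 (G.markedPartition ω ![a, b, c])))) =
      2 * (G.law3 p a b c 0 + G.law3 p a b c 2 + G.law3 p a b c 3) := by
    rw [← G.sum_weight_mul_rowU, Finset.mul_sum]
    exact Finset.sum_congr rfl fun ω _ => by ring
  have h3 : (∑ ω : Config E, weight p ω * (3 * rowInd3 0 (G.markedPartition ω ![a, b, c]))) =
      3 * G.law3 p a b c 0 := by
    rw [law3_eq_sum_rowInd3, Finset.mul_sum]
    exact Finset.sum_congr rfl fun ω _ => by ring
  rw [h2, h3]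

omit [Fintype E] [DecidableEq E] in
open Classical in
/-- **The kernel on an antipodal pair**:
`kernelHalf(Π(ρ), Π(ρᶜ)) = [c ~_ρ {a, b}] + 2·[c ~_ρ {a, b} ∧ a ~_{ρᶜ} b] − 3·[abc in ρ]`. -/
theorem kernelHalf_eq_ite (a b c : V) (ρ : Config E) :
    kernelHalf (G.markedPartition ρ ![a, b, c]) (G.markedPartition ρᶜ ![a, b, c]) =
      (if G.Conn ρ a c ∨ G.Conn ρ b c then 1 else 0) +
        2 * (if (G.Conn ρ a c ∨ G.Conn ρ b c) ∧ G.Conn ρᶜ a b then 1 else 0) -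
        3 * (if G.Conn ρ a b ∧ G.Conn ρ a c then 1 else 0) := by
  unfold kernelHalf rowAll3
  simp only [G.rowInd3_eq_ite]
  have e0 := G.partitionEvent_row_abc a b c
  have e1 := G.partitionEvent_row_ab_c a b c
  have e2 := G.partitionEvent_row_ac_b a b c
  have e3 := G.partitionEvent_row_bc_a a b c
  have e4 := G.partitionEvent_row_a_b_c a b c
  simp only [show rgs3 0 = ![0, 0, 0] from rfl, show rgs3 1 = ![0, 0, 1] from rfl,
    show rgs3 2 = ![0, 1, 0] from rfl, show rgs3 3 = ![0, 1, 1] from rfl,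
    show rgs3 4 = ![0, 1, 2] from rfl, e0, e1, e2, e3, e4, Set.mem_inter_iff, mem_connEvent,
    mem_sepEvent]
  rcases G.rows3_cases a b c ρ with ⟨hab, hac, hbc⟩ | ⟨hab, hac, hbc⟩ | ⟨hab, hac, hbc⟩ |
      ⟨hab, hac, hbc⟩ | ⟨hab, hac, hbc⟩ <;>
    rcases G.rows3_cases a b c ρᶜ with ⟨hab', hac', hbc'⟩ | ⟨hab', hac', hbc'⟩ |
      ⟨hab', hac', hbc'⟩ | ⟨hab', hac', hbc'⟩ | ⟨hab', hac', hbc'⟩ <;>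
    simp [hab, hac, hbc, hab', hac', hbc']

open Classical in
/-- **The class sum of `kernelHalf`** is `#U + 2·#{U ∧ a ~ b in the complement} − 3·#abc`. -/
theorem cubeSumQuad_kernelHalf_eq (a b c : V) :
    G.cubeSumQuad ![a, b, c] kernelHalf =
      ((Finset.univ.filter fun ρ : Config E => G.Conn ρ a c ∨ G.Conn ρ b c).card : ℝ) +
        2 * ((Finset.univ.filter fun ρ : Config E =>
          (G.Conn ρ a c ∨ G.Conn ρ b c) ∧ G.Conn ρᶜ a b).card : ℝ) -
        3 * ((Finset.univ.filter fun ρ : Config E => G.Conn ρ a b ∧ G.Conn ρ a c).card : ℝ) := by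
  unfold cubeSumQuad cubeSum
  simp only [G.kernelHalf_eq_ite, Finset.sum_add_distrib, Finset.sum_sub_distrib, ← Finset.mul_sum,
    Finset.sum_boole]

/-! ### Counting -/

omit [Fintype E] [DecidableEq E] in
/-- `¬ U` in the complement is `c` isolated there. -/
theorem not_U_iff_isCIso (ρ : Config E) (a b c : V) :
    ¬ (G.Conn ρ a c ∨ G.Conn ρ b c) ↔ G.IsCIso ρ a b c := by
  unfold IsCIso
  tauto

/-- The complement swaps the two copies. -/
theorem card_filter_compl_swap (P Q : Config E → Prop) [DecidablePred fun ρ : Config E => P ρ ∧ Q ρᶜ]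
    [DecidablePred fun ρ : Config E => Q ρ ∧ P ρᶜ] :
    (Finset.univ.filter fun ρ : Config E => P ρ ∧ Q ρᶜ).card =
      (Finset.univ.filter fun ρ : Config E => Q ρ ∧ P ρᶜ).card := by
  refine Finset.card_bij (fun ρ _ => ρᶜ) ?_ ?_ ?_
  · intro ρ hρ
    simp only [Finset.mem_filter, Finset.mem_univ, true_and, compl_compl] at hρ ⊢
    exact ⟨hρ.2, hρ.1⟩
  · intro ρ _ ρ' _ h
    exact compl_injective h
  · intro σ hσ
    refine ⟨σᶜ, ?_, compl_compl σ⟩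
    simp only [Finset.mem_filter, Finset.mem_univ, true_and, compl_compl] at hσ ⊢
    exact ⟨hσ.2, hσ.1⟩

open Classical in
/-- `#{U(ρ) ∧ a ~ b in ρᶜ} + #BotM = #abc` (the complement swap and p5's pairing). -/
theorem card_U_conn_compl_add_botM (a b c : V) :
    (Finset.univ.filter fun ρ : Config E => (G.Conn ρ a c ∨ G.Conn ρ b c) ∧ G.Conn ρᶜ a b).card +
        (Finset.univ.filter fun ρ : Config E => G.BotM ρ a b c).card =
      (Finset.univ.filter fun ρ : Config E => G.Conn ρ a b ∧ G.Conn ρ a c).card := by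
  have hswap := card_filter_compl_swap (E := E) (fun ρ => G.Conn ρ a c ∨ G.Conn ρ b c)
    (fun ρ => G.Conn ρ a b)
  rw [hswap]
  -- split `{a ~ b}` by `U` in the complement
  have hsplit := Finset.card_filter_add_card_filter_not
    (s := Finset.univ.filter fun ρ : Config E => G.Conn ρ a b)
    (fun ρ : Config E => G.Conn ρᶜ a c ∨ G.Conn ρᶜ b c)
  simp only [Finset.filter_filter] at hsplit
  have hneg : (Finset.univ.filter fun ρ : Config E =>
      G.Conn ρ a b ∧ ¬ (G.Conn ρᶜ a c ∨ G.Conn ρᶜ b c)).card =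
      (Finset.univ.filter fun ρ : Config E => G.Conn ρ a b ∧ G.IsCIso ρᶜ a b c).card := by
    congr 1
    exact Finset.filter_congr fun ρ _ => by rw [G.not_U_iff_isCIso]
  rw [hneg, G.card_conn_cIso_compl_eq_card_badM, G.card_badM_eq_add] at hsplit
  -- split `{a ~ b}` by `a ~ c`
  have hsplit2 := Finset.card_filter_add_card_filter_not
    (s := Finset.univ.filter fun ρ : Config E => G.Conn ρ a b) (fun ρ : Config E => G.Conn ρ a c)
  simp only [Finset.filter_filter] at hsplit2
  omega

open Classical in
/-- `#U = #abc + #ac|b + #bc|a`. -/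
theorem card_U_eq (a b c : V) :
    (Finset.univ.filter fun ρ : Config E => G.Conn ρ a c ∨ G.Conn ρ b c).card =
      (Finset.univ.filter fun ρ : Config E => G.Conn ρ a b ∧ G.Conn ρ a c).card +
        ((Finset.univ.filter fun ρ : Config E => G.Conn ρ a c ∧ ¬ G.Conn ρ a b).card +
          (Finset.univ.filter fun ρ : Config E => G.Conn ρ b c ∧ ¬ G.Conn ρ a b).card) := by
  have hsplit := Finset.card_filter_add_card_filter_not
    (s := Finset.univ.filter fun ρ : Config E => G.Conn ρ a c ∨ G.Conn ρ b c)
    (fun ρ : Config E => G.Conn ρ a b)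
  simp only [Finset.filter_filter] at hsplit
  have h1 : (Finset.univ.filter fun ρ : Config E => (G.Conn ρ a c ∨ G.Conn ρ b c) ∧ G.Conn ρ a b).card =
      (Finset.univ.filter fun ρ : Config E => G.Conn ρ a b ∧ G.Conn ρ a c).card := by
    congr 1
    refine Finset.filter_congr fun ρ _ => ?_
    obtain ⟨t1, t2, t3⟩ := G.conn_three_trans a b c (ω := ρ)
    constructor
    · rintro ⟨h | h, hab⟩
      · exact ⟨hab, h⟩
      · exact ⟨hab, t1 hab h⟩
    · rintro ⟨hab, hac⟩
      exact ⟨Or.inl hac, hab⟩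
  have h2 : (Finset.univ.filter fun ρ : Config E => (G.Conn ρ a c ∨ G.Conn ρ b c) ∧ ¬ G.Conn ρ a b).card =
      (Finset.univ.filter fun ρ : Config E => G.Conn ρ a c ∧ ¬ G.Conn ρ a b).card +
        (Finset.univ.filter fun ρ : Config E => G.Conn ρ b c ∧ ¬ G.Conn ρ a b).card := by
    rw [← Finset.card_union_of_disjoint]
    · congr 1
      ext ρ
      simp only [Finset.mem_union, Finset.mem_filter, Finset.mem_univ, true_and]
      tauto
    · rw [Finset.disjoint_left]
      intro ρ h1 h2
      simp only [Finset.mem_filter, Finset.mem_univ, true_and] at h1 h2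
      exact h1.2 ((G.conn_three_trans a b c (ω := ρ)).2.2 h1.1 h2.1)
  omega

open Classical in
/-- **The class lemma of `Q3½`**: the class sum of `kernelHalf` is nonnegative iff `2·#BotM ≤ #ac|b + #bc|a`
(p5's `TwoTimesIneq`). -/
theorem cubeSumQuad_kernelHalf_nonneg_iff (a b c : V) :
    0 ≤ G.cubeSumQuad ![a, b, c] kernelHalf ↔ G.TwoTimesIneq a b c := by
  rw [G.cubeSumQuad_kernelHalf_eq]
  unfold TwoTimesIneq
  have h1 := G.card_U_conn_compl_add_botM a b c
  have h2 := G.card_U_eq a b c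
  constructor
  · intro h
    have h1' : ((Finset.univ.filter fun ρ : Config E =>
        (G.Conn ρ a c ∨ G.Conn ρ b c) ∧ G.Conn ρᶜ a b).card : ℝ) +
        ((Finset.univ.filter fun ρ : Config E => G.BotM ρ a b c).card : ℝ) =
        ((Finset.univ.filter fun ρ : Config E => G.Conn ρ a b ∧ G.Conn ρ a c).card : ℝ) := by
      exact_mod_cast h1
    have h2' : ((Finset.univ.filter fun ρ : Config E => G.Conn ρ a c ∨ G.Conn ρ b c).card : ℝ) =
        ((Finset.univ.filter fun ρ : Config E => G.Conn ρ a b ∧ G.Conn ρ a c).card : ℝ) +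
          (((Finset.univ.filter fun ρ : Config E => G.Conn ρ a c ∧ ¬ G.Conn ρ a b).card : ℝ) +
            ((Finset.univ.filter fun ρ : Config E => G.Conn ρ b c ∧ ¬ G.Conn ρ a b).card : ℝ)) := by
      exact_mod_cast h2
    have : (2 * ((Finset.univ.filter fun ρ : Config E => G.BotM ρ a b c).card : ℝ)) ≤
        ((Finset.univ.filter fun ρ : Config E => G.Conn ρ a c ∧ ¬ G.Conn ρ a b).card : ℝ) +
          ((Finset.univ.filter fun ρ : Config E => G.Conn ρ b c ∧ ¬ G.Conn ρ a b).card : ℝ) := by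
      linarith
    exact_mod_cast this
  · intro h
    have h1' : ((Finset.univ.filter fun ρ : Config E =>
        (G.Conn ρ a c ∨ G.Conn ρ b c) ∧ G.Conn ρᶜ a b).card : ℝ) +
        ((Finset.univ.filter fun ρ : Config E => G.BotM ρ a b c).card : ℝ) =
        ((Finset.univ.filter fun ρ : Config E => G.Conn ρ a b ∧ G.Conn ρ a c).card : ℝ) := by
      exact_mod_cast h1
    have h2' : ((Finset.univ.filter fun ρ : Config E => G.Conn ρ a c ∨ G.Conn ρ b c).card : ℝ) =
        ((Finset.univ.filter fun ρ : Config E => G.Conn ρ a b ∧ G.Conn ρ a c).card : ℝ) +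
          (((Finset.univ.filter fun ρ : Config E => G.Conn ρ a c ∧ ¬ G.Conn ρ a b).card : ℝ) +
            ((Finset.univ.filter fun ρ : Config E => G.Conn ρ b c ∧ ¬ G.Conn ρ a b).card : ℝ)) := by
      exact_mod_cast h2
    have h' : (2 * ((Finset.univ.filter fun ρ : Config E => G.BotM ρ a b c).card : ℝ)) ≤
        ((Finset.univ.filter fun ρ : Config E => G.Conn ρ a c ∧ ¬ G.Conn ρ a b).card : ℝ) +
          ((Finset.univ.filter fun ρ : Config E => G.Conn ρ b c ∧ ¬ G.Conn ρ a b).card : ℝ) := by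
      exact_mod_cast h
    linarith

/-- **`Q3½` at every `p` on forests**: `3·x ≤ u·(1 + 2·v)` — mine-3's factor-2 strengthening of C-026
holds at every edge weight on every acyclic marked multigraph. -/
theorem Acyclic.q3half {G : MultiGraph V E} (hG : G.Acyclic) (a b c : V) (p : E → ℝ) (hp : IsProb p) :
    3 * G.law3 p a b c 0 ≤
      (G.law3 p a b c 0 + G.law3 p a b c 2 + G.law3 p a b c 3) *
        (1 + 2 * (G.law3 p a b c 0 + G.law3 p a b c 1)) := by
  have h := G.quadForm_nonneg_of_minors hp ![a, b, c] kernelHalf fun u v _ => by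
    classical
    rw [sureClass_vec]
    exact ((G.minor u v).cubeSumQuad_kernelHalf_nonneg_iff _ _ _).mpr
      (Acyclic.twoTimesIneq (hG.minor u v) _ _ _)
  rw [G.quadForm_kernelHalf, law3_sum_eq_one] at h
  linarith

/-- **`Q3½` on forests in mine-3's shape**: `P(a~b)·P(c iso) ≤ P(ab|c) + ½[P(ac|b) + P(bc|a)]`, i.e.
`(x + y₁)(y₁ + z) ≤ y₁ + (y₂ + y₃) / 2`. -/
theorem Acyclic.q3half' {G : MultiGraph V E} (hG : G.Acyclic) (a b c : V) (p : E → ℝ) (hp : IsProb p) :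
    (G.law3 p a b c 0 + G.law3 p a b c 1) * (G.law3 p a b c 1 + G.law3 p a b c 4) ≤
      G.law3 p a b c 1 + (G.law3 p a b c 2 + G.law3 p a b c 3) / 2 := by
  have h := hG.q3half a b c p hp
  have h1 := law3_sum_eq_one G p a b c
  have hz : G.law3 p a b c 4 = 1 - G.law3 p a b c 0 - G.law3 p a b c 1 - G.law3 p a b c 2 -
      G.law3 p a b c 3 := by linarith
  rw [hz]
  nlinarith [h]

end MultiGraph

end PercRepro
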